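import Summits.KontsevichZagierPeriods.KontsevichZagierPeriods.Theorems.UnfoldedStokesStokesGenerationStubSaSwapTransport
import Summits.KontsevichZagierPeriods.KontsevichZagierPeriods.Theorems.UnfoldedStokesStokesGenerationStubParamHalfAngleCertificate
import Summits.KontsevichZagierPeriods.KontsevichZagierPeriods.Theorems.UnfoldedStokesStokesGenerationStubFibrewiseCalibrationBands

/-!
# `StokesGeneration` (stmt-KontsevichZagierPeriods-3586) — line `fibrewise_stokes`, stub `stub_kinkedAngTransport`

Registered stub X10 (rung 10e, the angular-swap sector for semialgebraic loops) of the line `fibrewise_stokes`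
of the crux `StokesGeneration` (route UnfoldedStokes): **the closed-form transport, on the 4-cube `[0,1]⁴`
(coordinates `x₀, x₁`, homotopy variable `y = x₂`, silent `x₃`), of the transposition of an angular atom
`γ (ω_P(x₀) − ω_Q(x₁))` for KINKED loops** `P = A + iB`, `Q = E + iF` — real functions, `ℚ`-semialgebraic
(read on the interval coordinate) and continuous on `[0,1]`, differentiable on `(0,1)` off finite sets `kP`,
`kQ` of algebraic kink points, with bounded `ℚ`-semialgebraic derivative functions `A′, B′, E′, F′`;
`A, E > 0` on `[0,1]`, `γ` real algebraic, `ω_P = (A B′ − A′ B)/(A² + B²)`. This is the landed polynomial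
transport `stub_angTransport` (V1) verbatim, with kink sets: for `W = (1 − y) Q(x₁) + y P(x₀)` (`Re W > 0`)
write `d arg W = a₀ dx₀ + a₁ dx₁ + b dy`, `b = (B(x₀) E(x₁) − A(x₀) F(x₁))/|W|²`; the primitives, in the
directions `![2, 0, 1]`, are `G₀ = γ (y ω_P(x₀) + (1 − y) ω_Q(x₁) − (a₀ + a₁))` along `y` (no kinks: `y`
enters rationally; both boundary values vanish) and `G₁ = G₂ = γ b` along `x₀` (kink set `{x₀ ∈ kP}`) and
along `x₁` (kink set `{x₁ ∈ kQ}`), with fibre derivatives `D₁ = γ ∂₀ b`, `D₂ = γ ∂₁ b` off the kinks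
(quotient rule) and `D₀ = γ (ω_P − ω_Q) − (D₁ + D₂)` (closedness `∂_y (a₀ + a₁) = (∂₀ + ∂₁) b`, checked by
`ring`), whence `Σⱼ (Dⱼ − (Gⱼ|₁ − Gⱼ|₀))` is the relator minus the four boundary leftovers of `G₁, G₂`.
All data are rational expressions (denominators `|W|², A² + B², E² + F² > 0` on the cube) in the
coordinates, in `A, …, F′` read on one coordinate and in real-algebraic constants: `ℚ`-semialgebraic
(Bochnak–Coste–Roy, Prop. 2.2.6) and BOUNDED on the cube (bounded derivative functions, the rest continuous
on a compact set), hence integrable; `G₁ = G₂` is continuous on the cube, `G₀` is smooth along its fibres.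

References: M. Kontsevich, D. Zagier, *Periods* (2001), §1.1–1.2; J. Ayoub, *Une version relative de la
conjecture des périodes de Kontsevich–Zagier*, Ann. of Math. 181 (2015), Rem. 1.5; J. Bochnak, M. Coste,
M.-F. Roy, *Real Algebraic Geometry* (1998), Prop. 2.2.6.
-/

noncomputable section

-- `Summit.KontsevichZagierPeriods.KontsevichZagierPeriods.…` is the tree's mandated layout (single-conjunct summit).
set_option linter.dupNamespace false

namespace Summit.KontsevichZagierPeriods.KontsevichZagierPeriods.Cruxes.StokesGeneration.FibrewiseStokes

open MeasureTheory Set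
open Literature.NumberTheory.Transcendental
open Literature.NumberTheory.Transcendental.KZ
open Literature.ModelTheory.ExponentialFields (IsSemialgebraic)

/-! ## Semialgebraic-and-bounded functions (the regularity of the kinked transport data) -/

section SB

variable {m : ℕ} {S : Set (Fin m → ℝ)} {f g : (Fin m → ℝ) → ℝ}

/-- A semialgebraic function continuous on a compact set is semialgebraic and bounded. [folklore] -/
theorem kAngSB_of_sc (hf : IsSemialgebraicFunOn ℚ S f ∧ ContinuousOn f S) (hS : IsCompact S) :
    IsSemialgebraicFunOn ℚ S f ∧ ∃ C : ℝ, ∀ x ∈ S, |f x| ≤ C :=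
  ⟨hf.1, angTrSC_bound hf hS⟩

/-- Semialgebraic bounded functions are closed under sums. [folklore] -/
theorem kAngSB_add (hf : IsSemialgebraicFunOn ℚ S f ∧ ∃ C : ℝ, ∀ x ∈ S, |f x| ≤ C)
    (hg : IsSemialgebraicFunOn ℚ S g ∧ ∃ C : ℝ, ∀ x ∈ S, |g x| ≤ C) :
    IsSemialgebraicFunOn ℚ S (fun x => f x + g x) ∧ ∃ C : ℝ, ∀ x ∈ S, |f x + g x| ≤ C := by
  obtain ⟨⟨C, hC⟩, ⟨C', hC'⟩⟩ := And.intro hf.2 hg.2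
  exact ⟨hf.1.fun_add hg.1, C + C', fun x hx => (abs_add_le _ _).trans (add_le_add (hC x hx) (hC' x hx))⟩

/-- Semialgebraic bounded functions are closed under differences. [folklore] -/
theorem kAngSB_sub (hf : IsSemialgebraicFunOn ℚ S f ∧ ∃ C : ℝ, ∀ x ∈ S, |f x| ≤ C)
    (hg : IsSemialgebraicFunOn ℚ S g ∧ ∃ C : ℝ, ∀ x ∈ S, |g x| ≤ C) :
    IsSemialgebraicFunOn ℚ S (fun x => f x - g x) ∧ ∃ C : ℝ, ∀ x ∈ S, |f x - g x| ≤ C := by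
  obtain ⟨⟨C, hC⟩, ⟨C', hC'⟩⟩ := And.intro hf.2 hg.2
  exact ⟨hf.1.fun_sub hg.1, C + C', fun x hx => (abs_sub _ _).trans (add_le_add (hC x hx) (hC' x hx))⟩

/-- Semialgebraic bounded functions are closed under products. [folklore] -/
theorem kAngSB_mul (hf : IsSemialgebraicFunOn ℚ S f ∧ ∃ C : ℝ, ∀ x ∈ S, |f x| ≤ C)
    (hg : IsSemialgebraicFunOn ℚ S g ∧ ∃ C : ℝ, ∀ x ∈ S, |g x| ≤ C) :
    IsSemialgebraicFunOn ℚ S (fun x => f x * g x) ∧ ∃ C : ℝ, ∀ x ∈ S, |f x * g x| ≤ C := by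
  obtain ⟨⟨C, hC⟩, ⟨C', hC'⟩⟩ := And.intro hf.2 hg.2
  exact ⟨hf.1.fun_mul hg.1, C * C', fun x hx => (abs_mul _ _).trans_le
    (mul_le_mul (hC x hx) (hC' x hx) (abs_nonneg _) ((abs_nonneg _).trans (hC x hx)))⟩

/-- Quotients of semialgebraic bounded functions by semialgebraic functions continuous and non-vanishing
on a compact set are semialgebraic and bounded. [folklore] -/
theorem kAngSB_div (hf : IsSemialgebraicFunOn ℚ S f ∧ ∃ C : ℝ, ∀ x ∈ S, |f x| ≤ C)
    (hg : IsSemialgebraicFunOn ℚ S g ∧ ContinuousOn g S) (hS : IsCompact S) (h0 : ∀ x ∈ S, g x ≠ 0) :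
    IsSemialgebraicFunOn ℚ S (fun x => f x / g x) ∧ ∃ C : ℝ, ∀ x ∈ S, |f x / g x| ≤ C := by
  obtain ⟨C, hC⟩ := hf.2
  obtain ⟨C', hC'⟩ := hS.exists_bound_of_continuousOn (hg.2.inv₀ h0)
  refine ⟨hf.1.div hg.1 h0, C * C', fun x hx => ?_⟩
  rw [div_eq_mul_inv, abs_mul]
  exact mul_le_mul (hC x hx) (by simpa using hC' x hx) (abs_nonneg _) ((abs_nonneg _).trans (hC x hx))

end SB

/-! ## The transport -/

/-- **Registered stub `stub_kinkedAngTransport` (rung 10e, X10): closed-form transport of the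
angular-swap relator on the 4-cube for kinked loops.** For real functions `A, B, E, F`,
`ℚ`-semialgebraic and continuous on `[0,1]`, differentiable on `(0,1)` off finite sets `kP`, `kQ` of
algebraic points with bounded `ℚ`-semialgebraic derivative functions `A′, B′, E′, F′`, `A, E > 0` on
`[0,1]`, and real algebraic `γ`, the relator `γ (ω_P(x₀) − ω_Q(x₁))` (`P = A + iB`, `Q = E + iF`,
`ω_P = (A B′ − A′ B)/(A² + B²)`) equals, on `[0,1]⁴`, the sum of three fibrewise Stokes elements
`Dⱼ − (Gⱼ|₁ − Gⱼ|₀)` in the directions `![2, 0, 1]` (`G₀ = γ (y ω_P + (1 − y) ω_Q − (a₀ + a₁))`, no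
kinks; `G₁ = G₂ = γ b` with kink sets `{x₀ ∈ kP}`, `{x₁ ∈ kQ}`; `d arg((1 − y) Q(x₁) + y P(x₀)) =
a₀ dx₀ + a₁ dx₁ + b dy`, `y = x₂`), minus the four boundary leftovers of `G₁, G₂`; all data
`ℚ`-semialgebraic and bounded on the closed cube. [cite: KontsevichZagier2001, §1.2 rule (2)] -/
theorem stub_kinkedAngTransport :
    ∀ (γ : ℝ) (A B E F A' B' E' F' : ℝ → ℝ) (kP kQ : Finset ℝ), IsAlgebraic ℚ γ →
      IsSemialgebraicFunOn ℚ (Set.pi Set.univ (fun _ : Fin 1 => Set.Icc (0:ℝ) 1)) (fun z => A (z 0)) → IsSemialgebraicFunOn ℚ (Set.pi Set.univ (fun _ : Fin 1 => Set.Icc (0:ℝ) 1)) (fun z => B (z 0)) →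
      IsSemialgebraicFunOn ℚ (Set.pi Set.univ (fun _ : Fin 1 => Set.Icc (0:ℝ) 1)) (fun z => E (z 0)) → IsSemialgebraicFunOn ℚ (Set.pi Set.univ (fun _ : Fin 1 => Set.Icc (0:ℝ) 1)) (fun z => F (z 0)) →
      IsSemialgebraicFunOn ℚ (Set.pi Set.univ (fun _ : Fin 1 => Set.Icc (0:ℝ) 1)) (fun z => A' (z 0)) → IsSemialgebraicFunOn ℚ (Set.pi Set.univ (fun _ : Fin 1 => Set.Icc (0:ℝ) 1)) (fun z => B' (z 0)) →
      IsSemialgebraicFunOn ℚ (Set.pi Set.univ (fun _ : Fin 1 => Set.Icc (0:ℝ) 1)) (fun z => E' (z 0)) → IsSemialgebraicFunOn ℚ (Set.pi Set.univ (fun _ : Fin 1 => Set.Icc (0:ℝ) 1)) (fun z => F' (z 0)) →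
      ContinuousOn A (Set.Icc (0:ℝ) 1) → ContinuousOn B (Set.Icc (0:ℝ) 1) →
      ContinuousOn E (Set.Icc (0:ℝ) 1) → ContinuousOn F (Set.Icc (0:ℝ) 1) →
      (∃ Bd : ℝ, ∀ u ∈ Set.Icc (0:ℝ) 1, |A' u| ≤ Bd ∧ |B' u| ≤ Bd ∧ |E' u| ≤ Bd ∧ |F' u| ≤ Bd) →
      (∀ c ∈ kP, IsAlgebraic ℚ c) → (∀ c ∈ kQ, IsAlgebraic ℚ c) →
      (∀ u ∈ Set.Ioo (0:ℝ) 1, u ∉ kP → HasDerivAt A (A' u) u ∧ HasDerivAt B (B' u) u) →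
      (∀ u ∈ Set.Ioo (0:ℝ) 1, u ∉ kQ → HasDerivAt E (E' u) u ∧ HasDerivAt F (F' u) u) →
      (∀ u ∈ Set.Icc (0:ℝ) 1, 0 < A u) → (∀ u ∈ Set.Icc (0:ℝ) 1, 0 < E u) →
      ∃ (G D : Fin 3 → (Fin 4 → ℝ) → ℝ) (K : Fin 3 → Set (Fin 4 → ℝ)) (r : Fin 3 → IntegralRep 4),
        (∀ j, IsSemialgebraicFunOn ℚ (Set.pi Set.univ (fun _ : Fin 4 => Set.Icc (0:ℝ) 1)) (G j) ∧
          IsSemialgebraicFunOn ℚ (Set.pi Set.univ (fun _ : Fin 4 => Set.Icc (0:ℝ) 1)) (D j) ∧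
          IsSemialgebraic ℚ (K j) ∧
          (∃ Bd : ℝ, ∀ x ∈ (Set.pi Set.univ (fun _ : Fin 4 => Set.Icc (0:ℝ) 1)), |(G j) x| ≤ Bd) ∧
          (∀ x ∈ (Set.pi Set.univ (fun _ : Fin 4 => Set.Icc (0:ℝ) 1)), Set.Finite {s : ℝ | Function.update x ((![2, 0, 1] : Fin 3 → Fin 4) j) s ∈ (K j)}) ∧
          (∀ x ∈ (Set.pi Set.univ (fun _ : Fin 4 => Set.Icc (0:ℝ) 1)),
            ContinuousOn (fun s : ℝ => (G j) (Function.update x ((![2, 0, 1] : Fin 3 → Fin 4) j) s)) (Set.Icc (0:ℝ) 1)) ∧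
          (∀ x ∈ (Set.pi Set.univ (fun _ : Fin 4 => Set.Icc (0:ℝ) 1)), x ∉ (K j) → x ((![2, 0, 1] : Fin 3 → Fin 4) j) ∈ Set.Ioo (0:ℝ) 1 →
            HasDerivAt (fun s : ℝ => (G j) (Function.update x ((![2, 0, 1] : Fin 3 → Fin 4) j) s)) ((D j) x)
              (x ((![2, 0, 1] : Fin 3 → Fin 4) j)))) ∧
        (∀ j, (r j).domain = (Set.pi Set.univ (fun _ : Fin 4 => Set.Icc (0:ℝ) 1)) ∧
          ∀ x ∈ (Set.pi Set.univ (fun _ : Fin 4 => Set.Icc (0:ℝ) 1)), (r j).integrand x =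
            D j x - (G j (Function.update x ((![2, 0, 1] : Fin 3 → Fin 4) j) 1) -
              G j (Function.update x ((![2, 0, 1] : Fin 3 → Fin 4) j) 0))) ∧
        ∀ x ∈ (Set.pi Set.univ (fun _ : Fin 4 => Set.Icc (0:ℝ) 1)), ∑ j, (r j).integrand x =
          γ * ((A (x 0) * B' (x 0) - A' (x 0) * B (x 0)) / (A (x 0) ^ 2 + B (x 0) ^ 2) -
                (E (x 1) * F' (x 1) - E' (x 1) * F (x 1)) / (E (x 1) ^ 2 + F (x 1) ^ 2)) -
          γ * ((B 1 * E (x 1) - A 1 * F (x 1)) /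
                  (((1 - x 2) * E (x 1) + x 2 * A 1) ^ 2 + ((1 - x 2) * F (x 1) + x 2 * B 1) ^ 2) -
                (B 0 * E (x 1) - A 0 * F (x 1)) /
                  (((1 - x 2) * E (x 1) + x 2 * A 0) ^ 2 + ((1 - x 2) * F (x 1) + x 2 * B 0) ^ 2)) -
          γ * ((B (x 0) * E 1 - A (x 0) * F 1) /
                  (((1 - x 2) * E 1 + x 2 * A (x 0)) ^ 2 + ((1 - x 2) * F 1 + x 2 * B (x 0)) ^ 2) -
                (B (x 0) * E 0 - A (x 0) * F 0) /
                  (((1 - x 2) * E 0 + x 2 * A (x 0)) ^ 2 + ((1 - x 2) * F 0 + x 2 * B (x 0)) ^ 2)) := by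
  intro γ A B E F A' B' E' F' kP kQ hγ hAsa hBsa hEsa hFsa hA'sa hB'sa hE'sa hF'sa hAc hBc hEc hFc hBd hkP hkQ
    hPd hQd hApos hEpos
  obtain ⟨Bd, hBd⟩ := hBd
  -- the closed 4-cube and what holds on it
  set S : Set (Fin 4 → ℝ) := Set.pi Set.univ (fun _ : Fin 4 => Set.Icc (0:ℝ) 1) with hS
  have hSsa : IsSemialgebraic ℚ S := by rw [hS, ← cube_eq_pi]; exact isSemialgebraic_cube
  have hSc : IsCompact S := isCompact_univ_pi fun _ => isCompact_Icc
  have hmem : ∀ x ∈ S, ∀ i, x i ∈ Set.Icc (0:ℝ) 1 := fun x hx i => (Set.mem_univ_pi.mp hx) i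
  obtain ⟨h0I, h1I⟩ : (0:ℝ) ∈ Set.Icc (0:ℝ) 1 ∧ (1:ℝ) ∈ Set.Icc (0:ℝ) 1 := ⟨⟨le_rfl, zero_le_one⟩, ⟨zero_le_one, le_rfl⟩⟩
  obtain ⟨h02, h10, h01⟩ : ((0 : Fin 4) ≠ 2 ∧ (1 : Fin 4) ≠ 2) ∧ ((1 : Fin 4) ≠ 0 ∧ (2 : Fin 4) ≠ 0) ∧
      ((0 : Fin 4) ≠ 1 ∧ (2 : Fin 4) ≠ 1) := by decide
  have hupd : ∀ x ∈ S, ∀ (i : Fin 4), ∀ s ∈ Set.Icc (0:ℝ) 1, Function.update x i s ∈ S := fun x hx i s hs =>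
    Set.mem_univ_pi.mpr fun l => by
      rcases eq_or_ne l i with rfl | hli
      · simpa using hs
      · rw [Function.update_of_ne hli]; exact hmem x hx l
  -- positivity: `Re W = (1 - y) E(v) + y A(u) > 0`, hence `|W|² ≠ 0`; `A² + B², E² + F² ≠ 0`
  have hWne : ∀ u ∈ Set.Icc (0:ℝ) 1, ∀ v ∈ Set.Icc (0:ℝ) 1, ∀ x ∈ S, ∀ p q : ℝ,
      ((1 - x 2) * E v + x 2 * A u) ^ 2 + ((1 - x 2) * q + x 2 * p) ^ 2 ≠ 0 :=
    fun u hu v hv x hx p q =>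
      angTr_sq_add_sq_ne_zero _ (swapTr_combo_pos (hApos u hu) (hEpos v hv) (hmem x hx 2))
  have hNne : ∀ x ∈ S, ((1 - x 2) * E (x 1) + x 2 * A (x 0)) ^ 2 +
      ((1 - x 2) * F (x 1) + x 2 * B (x 0)) ^ 2 ≠ 0 := fun x hx =>
    hWne _ (hmem x hx 0) _ (hmem x hx 1) x hx _ _
  have hPne : ∀ x ∈ S, A (x 0) ^ 2 + B (x 0) ^ 2 ≠ 0 := fun x hx =>
    angTr_sq_add_sq_ne_zero _ (hApos _ (hmem x hx 0))
  have hQne : ∀ x ∈ S, E (x 1) ^ 2 + F (x 1) ^ 2 ≠ 0 := fun x hx =>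
    angTr_sq_add_sq_ne_zero _ (hEpos _ (hmem x hx 1))
  -- witnesses: `G₀` (along `y`), `G₁ = G₂ = γ b` (along `x₀`, `x₁`), `D₁ = γ ∂₀ b`, `D₂ = γ ∂₁ b`,
  -- `D₀ = γ (ω_P − ω_Q) − (D₁ + D₂)`; the integrands `I₁, I₂` of the elements `1, 2`
  obtain ⟨G0, hG0⟩ : ∃ G0 : (Fin 4 → ℝ) → ℝ, G0 = fun x =>
      γ * (x 2 * ((A (x 0) * B' (x 0) - A' (x 0) * B (x 0)) / (A (x 0) ^ 2 + B (x 0) ^ 2)) +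
          (1 - x 2) * ((E (x 1) * F' (x 1) - E' (x 1) * F (x 1)) / (E (x 1) ^ 2 + F (x 1) ^ 2)) -
          ((x 2 * B' (x 0) + (1 - x 2) * F' (x 1)) * ((1 - x 2) * E (x 1) + x 2 * A (x 0)) -
              (x 2 * A' (x 0) + (1 - x 2) * E' (x 1)) * ((1 - x 2) * F (x 1) + x 2 * B (x 0))) /
            (((1 - x 2) * E (x 1) + x 2 * A (x 0)) ^ 2 + ((1 - x 2) * F (x 1) + x 2 * B (x 0)) ^ 2)) := ⟨_, rfl⟩
  obtain ⟨G1, hG1⟩ : ∃ G1 : (Fin 4 → ℝ) → ℝ, G1 = fun x =>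
      γ * (B (x 0) * E (x 1) - A (x 0) * F (x 1)) /
        (((1 - x 2) * E (x 1) + x 2 * A (x 0)) ^ 2 + ((1 - x 2) * F (x 1) + x 2 * B (x 0)) ^ 2) := ⟨_, rfl⟩
  obtain ⟨D1, hD1⟩ : ∃ D1 : (Fin 4 → ℝ) → ℝ, D1 = fun x =>
      γ * ((B' (x 0) * E (x 1) - A' (x 0) * F (x 1)) *
            (((1 - x 2) * E (x 1) + x 2 * A (x 0)) ^ 2 + ((1 - x 2) * F (x 1) + x 2 * B (x 0)) ^ 2) -
          (B (x 0) * E (x 1) - A (x 0) * F (x 1)) *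
            (2 * ((1 - x 2) * E (x 1) + x 2 * A (x 0)) * (x 2 * A' (x 0)) +
              2 * ((1 - x 2) * F (x 1) + x 2 * B (x 0)) * (x 2 * B' (x 0)))) /
        (((1 - x 2) * E (x 1) + x 2 * A (x 0)) ^ 2 + ((1 - x 2) * F (x 1) + x 2 * B (x 0)) ^ 2) ^ 2 := ⟨_, rfl⟩
  obtain ⟨D2, hD2⟩ : ∃ D2 : (Fin 4 → ℝ) → ℝ, D2 = fun x =>
      γ * ((B (x 0) * E' (x 1) - A (x 0) * F' (x 1)) *
            (((1 - x 2) * E (x 1) + x 2 * A (x 0)) ^ 2 + ((1 - x 2) * F (x 1) + x 2 * B (x 0)) ^ 2) -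
          (B (x 0) * E (x 1) - A (x 0) * F (x 1)) *
            (2 * ((1 - x 2) * E (x 1) + x 2 * A (x 0)) * ((1 - x 2) * E' (x 1)) +
              2 * ((1 - x 2) * F (x 1) + x 2 * B (x 0)) * ((1 - x 2) * F' (x 1)))) /
        (((1 - x 2) * E (x 1) + x 2 * A (x 0)) ^ 2 + ((1 - x 2) * F (x 1) + x 2 * B (x 0)) ^ 2) ^ 2 := ⟨_, rfl⟩
  obtain ⟨D0, hD0⟩ : ∃ D0 : (Fin 4 → ℝ) → ℝ, D0 = fun x =>
      γ * ((A (x 0) * B' (x 0) - A' (x 0) * B (x 0)) / (A (x 0) ^ 2 + B (x 0) ^ 2) -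
            (E (x 1) * F' (x 1) - E' (x 1) * F (x 1)) / (E (x 1) ^ 2 + F (x 1) ^ 2)) -
        (D1 x + D2 x) := ⟨_, rfl⟩
  obtain ⟨I1, hI1⟩ : ∃ I1 : (Fin 4 → ℝ) → ℝ, I1 = fun x =>
      D1 x - (G1 (Function.update x 0 1) - G1 (Function.update x 0 0)) := ⟨_, rfl⟩
  obtain ⟨I2, hI2⟩ : ∃ I2 : (Fin 4 → ℝ) → ℝ, I2 = fun x =>
      D2 x - (G1 (Function.update x 1 1) - G1 (Function.update x 1 0)) := ⟨_, rfl⟩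
  -- both boundary values of `G₀` vanish (`W|_{y=1} = P(x₀)`, `W|_{y=0} = Q(x₁)`); the faces of `G₁`
  have hG0b : ∀ x, G0 (Function.update x 2 1) = 0 ∧ G0 (Function.update x 2 0) = 0 := fun x => by
    constructor <;>
    · simp only [hG0, Function.update_self, Function.update_of_ne h02.1, Function.update_of_ne h02.2]; ring
  have hG1_x0 : ∀ c x, G1 (Function.update x 0 c) = γ * (B c * E (x 1) - A c * F (x 1)) /
      (((1 - x 2) * E (x 1) + x 2 * A c) ^ 2 + ((1 - x 2) * F (x 1) + x 2 * B c) ^ 2) := fun c x => by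
    simp only [hG1, Function.update_self, Function.update_of_ne h10.1, Function.update_of_ne h10.2]
  have hG1_x1 : ∀ c x, G1 (Function.update x 1 c) = γ * (B (x 0) * E c - A (x 0) * F c) /
      (((1 - x 2) * E c + x 2 * A (x 0)) ^ 2 + ((1 - x 2) * F c + x 2 * B (x 0)) ^ 2) := fun c x => by
    simp only [hG1, Function.update_self, Function.update_of_ne h01.1, Function.update_of_ne h01.2]
  -- atoms on the cube: semialgebraic and continuous (`A, B, E, F`, coordinates, constants), resp. bounded (`A′, …, F′`)
  have sb : ∀ {f : (Fin 4 → ℝ) → ℝ}, IsSemialgebraicFunOn ℚ S f ∧ ContinuousOn f S →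
      IsSemialgebraicFunOn ℚ S f ∧ ∃ C : ℝ, ∀ x ∈ S, |f x| ≤ C := fun hf => kAngSB_of_sc hf hSc
  have hy := angTrSC_apply hSsa 2
  have h1y := angTrSC_sub (angTrSC_const hSsa isAlgebraic_one) hy
  have hγ' := angTrSC_const hSsa hγ
  have h2 := angTrSC_const hSsa (isAlgebraic_nat 2 : IsAlgebraic ℚ ((2:ℕ):ℝ))
  have hA0 := saSwapTrSC_coord hAsa hAc (0 : Fin 4)
  have hB0 := saSwapTrSC_coord hBsa hBc (0 : Fin 4)
  have hE1 := saSwapTrSC_coord hEsa hEc (1 : Fin 4)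
  have hF1 := saSwapTrSC_coord hFsa hFc (1 : Fin 4)
  have crd : ∀ {g : ℝ → ℝ} (i : Fin 4), IsSemialgebraicFunOn ℚ (Set.pi Set.univ (fun _ : Fin 1 => Set.Icc (0:ℝ) 1)) (fun z => g (z 0)) →
      (∀ u ∈ Set.Icc (0:ℝ) 1, |g u| ≤ Bd) → IsSemialgebraicFunOn ℚ S (fun x => g (x i)) ∧ ∃ C : ℝ, ∀ x ∈ S, |g (x i)| ≤ C :=
    fun i hg hb => ⟨paramHalfAng_sa_coord i hg, Bd, fun x hx => hb _ (hmem x hx i)⟩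
  have hA'0 := crd 0 hA'sa fun u hu => (hBd u hu).1
  have hB'0 := crd 0 hB'sa fun u hu => (hBd u hu).2.1
  have hE'1 := crd 1 hE'sa fun u hu => (hBd u hu).2.2.1
  have hF'1 := crd 1 hF'sa fun u hu => (hBd u hu).2.2.2
  -- `Re W`, `Im W`, `|W|²`, `B E − A F`; the angular atoms `ω_P(x₀)`, `ω_Q(x₁)` (bounded, not continuous)
  have hR := angTrSC_add (angTrSC_mul h1y hE1) (angTrSC_mul hy hA0)
  have hI := angTrSC_add (angTrSC_mul h1y hF1) (angTrSC_mul hy hB0)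
  have hN := angTrSC_add (angTrSC_pow hR 2) (angTrSC_pow hI 2)
  have hbn := angTrSC_sub (angTrSC_mul hB0 hE1) (angTrSC_mul hA0 hF1)
  have hωP := kAngSB_div (kAngSB_sub (kAngSB_mul (sb hA0) hB'0) (kAngSB_mul hA'0 (sb hB0)))
    (angTrSC_add (angTrSC_pow hA0 2) (angTrSC_pow hB0 2)) hSc hPne
  have hωQ := kAngSB_div (kAngSB_sub (kAngSB_mul (sb hE1) hF'1) (kAngSB_mul hE'1 (sb hF1)))
    (angTrSC_add (angTrSC_pow hE1 2) (angTrSC_pow hF1 2)) hSc hQne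
  -- `γ b` with `A(x₀), B(x₀)` resp. `E(x₁), F(x₁)` replaced by arbitrary atoms (so as to cover the faces)
  have hbsc : ∀ {a b e f : (Fin 4 → ℝ) → ℝ},
      IsSemialgebraicFunOn ℚ S a ∧ ContinuousOn a S → IsSemialgebraicFunOn ℚ S b ∧ ContinuousOn b S →
      IsSemialgebraicFunOn ℚ S e ∧ ContinuousOn e S → IsSemialgebraicFunOn ℚ S f ∧ ContinuousOn f S →
      (∀ x ∈ S, ((1 - x 2) * e x + x 2 * a x) ^ 2 + ((1 - x 2) * f x + x 2 * b x) ^ 2 ≠ 0) →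
      IsSemialgebraicFunOn ℚ S (fun x => γ * (b x * e x - a x * f x) /
          (((1 - x 2) * e x + x 2 * a x) ^ 2 + ((1 - x 2) * f x + x 2 * b x) ^ 2)) ∧
        ContinuousOn (fun x => γ * (b x * e x - a x * f x) /
          (((1 - x 2) * e x + x 2 * a x) ^ 2 + ((1 - x 2) * f x + x 2 * b x) ^ 2)) S :=
    fun ha hb he hf hne => angTrSC_div (angTrSC_mul hγ' (angTrSC_sub (angTrSC_mul hb he) (angTrSC_mul ha hf)))
      (angTrSC_add (angTrSC_pow (angTrSC_add (angTrSC_mul h1y he) (angTrSC_mul hy ha)) 2)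
        (angTrSC_pow (angTrSC_add (angTrSC_mul h1y hf) (angTrSC_mul hy hb)) 2)) hne
  -- regularity of the witnesses (closure under field operations, BCR Prop. 2.2.6)
  have hG0sb : IsSemialgebraicFunOn ℚ S G0 ∧ ∃ C : ℝ, ∀ x ∈ S, |G0 x| ≤ C := by
    rw [hG0]
    exact kAngSB_mul (sb hγ') (kAngSB_sub (kAngSB_add (kAngSB_mul (sb hy) hωP) (kAngSB_mul (sb h1y) hωQ))
      (kAngSB_div (kAngSB_sub
        (kAngSB_mul (kAngSB_add (kAngSB_mul (sb hy) hB'0) (kAngSB_mul (sb h1y) hF'1)) (sb hR))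
        (kAngSB_mul (kAngSB_add (kAngSB_mul (sb hy) hA'0) (kAngSB_mul (sb h1y) hE'1)) (sb hI))) hN hSc hNne))
  have hG1sc : IsSemialgebraicFunOn ℚ S G1 ∧ ContinuousOn G1 S := by
    rw [hG1]
    exact hbsc hA0 hB0 hE1 hF1 hNne
  have hD1sb : IsSemialgebraicFunOn ℚ S D1 ∧ ∃ C : ℝ, ∀ x ∈ S, |D1 x| ≤ C := by
    rw [hD1]
    exact kAngSB_div (kAngSB_mul (sb hγ') (kAngSB_sub
      (kAngSB_mul (kAngSB_sub (kAngSB_mul hB'0 (sb hE1)) (kAngSB_mul hA'0 (sb hF1))) (sb hN))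
      (kAngSB_mul (sb hbn) (kAngSB_add (kAngSB_mul (sb (angTrSC_mul h2 hR)) (kAngSB_mul (sb hy) hA'0))
        (kAngSB_mul (sb (angTrSC_mul h2 hI)) (kAngSB_mul (sb hy) hB'0)))))) (angTrSC_pow hN 2) hSc
      fun x hx => pow_ne_zero 2 (hNne x hx)
  have hD2sb : IsSemialgebraicFunOn ℚ S D2 ∧ ∃ C : ℝ, ∀ x ∈ S, |D2 x| ≤ C := by
    rw [hD2]
    exact kAngSB_div (kAngSB_mul (sb hγ') (kAngSB_sub
      (kAngSB_mul (kAngSB_sub (kAngSB_mul (sb hB0) hE'1) (kAngSB_mul (sb hA0) hF'1)) (sb hN))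
      (kAngSB_mul (sb hbn) (kAngSB_add (kAngSB_mul (sb (angTrSC_mul h2 hR)) (kAngSB_mul (sb h1y) hE'1))
        (kAngSB_mul (sb (angTrSC_mul h2 hI)) (kAngSB_mul (sb h1y) hF'1)))))) (angTrSC_pow hN 2) hSc
      fun x hx => pow_ne_zero 2 (hNne x hx)
  have hD0sb : IsSemialgebraicFunOn ℚ S D0 ∧ ∃ C : ℝ, ∀ x ∈ S, |D0 x| ≤ C := by
    rw [hD0]
    exact kAngSB_sub (kAngSB_mul (sb hγ') (kAngSB_sub hωP hωQ)) (kAngSB_add hD1sb hD2sb)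
  have hI1sb : IsSemialgebraicFunOn ℚ S I1 ∧ ∃ C : ℝ, ∀ x ∈ S, |I1 x| ≤ C := by
    rw [hI1]; simp only [hG1_x0]
    exact kAngSB_sub hD1sb (sb (angTrSC_sub
      (hbsc (saSwapTrSC_value hSsa hAsa h1I isAlgebraic_one) (saSwapTrSC_value hSsa hBsa h1I isAlgebraic_one)
        hE1 hF1 fun x hx => hWne 1 h1I _ (hmem x hx 1) x hx _ _)
      (hbsc (saSwapTrSC_value hSsa hAsa h0I isAlgebraic_zero) (saSwapTrSC_value hSsa hBsa h0I isAlgebraic_zero)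
        hE1 hF1 fun x hx => hWne 0 h0I _ (hmem x hx 1) x hx _ _)))
  have hI2sb : IsSemialgebraicFunOn ℚ S I2 ∧ ∃ C : ℝ, ∀ x ∈ S, |I2 x| ≤ C := by
    rw [hI2]; simp only [hG1_x1]
    exact kAngSB_sub hD2sb (sb (angTrSC_sub
      (hbsc hA0 hB0 (saSwapTrSC_value hSsa hEsa h1I isAlgebraic_one) (saSwapTrSC_value hSsa hFsa h1I isAlgebraic_one)
        fun x hx => hWne _ (hmem x hx 0) 1 h1I x hx _ _)
      (hbsc hA0 hB0 (saSwapTrSC_value hSsa hEsa h0I isAlgebraic_zero) (saSwapTrSC_value hSsa hFsa h0I isAlgebraic_zero)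
        fun x hx => hWne _ (hmem x hx 0) 0 h0I x hx _ _)))
  -- the kink sets: none for the element along `y`, `{x₀ ∈ kP}` and `{x₁ ∈ kQ}` for the elements along `x₀`, `x₁`
  have hKsa : ∀ (T : Finset ℝ), (∀ c ∈ T, IsAlgebraic ℚ c) → ∀ i : Fin 4,
      IsSemialgebraic ℚ {x : Fin 4 → ℝ | x i ∈ (T : Set ℝ)} := by
    intro T hT i
    convert IsSemialgebraic.biUnion T (fun c => {x : Fin 4 → ℝ | x i = c}) fun c hc =>
      isSemialgebraic_setOf_apply_eq_of_isAlgebraic (hT c hc) i using 1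
    ext x
    simp
  -- packaged as `Fin 3`-families (`G₂ = G₁`)
  set G : Fin 3 → (Fin 4 → ℝ) → ℝ := ![G0, G1, G1]
  set D : Fin 3 → (Fin 4 → ℝ) → ℝ := ![D0, D1, D2]
  set K : Fin 3 → Set (Fin 4 → ℝ) := ![∅, {x | x 0 ∈ (kP : Set ℝ)}, {x | x 1 ∈ (kQ : Set ℝ)}]
  set I : Fin 3 → (Fin 4 → ℝ) → ℝ := ![D0, I1, I2]
  have hGsb : ∀ j, IsSemialgebraicFunOn ℚ S (G j) ∧ ∃ C : ℝ, ∀ x ∈ S, |G j x| ≤ C := fun j => by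
    fin_cases j; exacts [hG0sb, sb hG1sc, sb hG1sc]
  have hDsa : ∀ j, IsSemialgebraicFunOn ℚ S (D j) := fun j => by
    fin_cases j; exacts [hD0sb.1, hD1sb.1, hD2sb.1]
  have hIsb : ∀ j, IsSemialgebraicFunOn ℚ S (I j) ∧ ∃ C : ℝ, ∀ x ∈ S, |I j x| ≤ C := fun j => by
    fin_cases j; exacts [hD0sb, hI1sb, hI2sb]
  have hK : ∀ j, IsSemialgebraic ℚ (K j) := fun j => by
    fin_cases j; exacts [Literature.ModelTheory.ExponentialFields.isSemialgebraic_empty, hKsa kP hkP 0, hKsa kQ hkQ 1]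
  have hKfin : ∀ j, ∀ x ∈ S, Set.Finite {s : ℝ | Function.update x ((![2, 0, 1] : Fin 3 → Fin 4) j) s ∈ K j} := by
    intro j x _
    fin_cases j
    · show Set.Finite {s : ℝ | Function.update x 2 s ∈ (∅ : Set (Fin 4 → ℝ))}; simp
    · show Set.Finite {s : ℝ | Function.update x 0 s ∈ {z : Fin 4 → ℝ | z 0 ∈ (kP : Set ℝ)}}; simp
    · show Set.Finite {s : ℝ | Function.update x 1 s ∈ {z : Fin 4 → ℝ | z 1 ∈ (kQ : Set ℝ)}}; simp
  -- fibre derivatives: for `G₀` (at every point of the closed cube) by the closedness `∂_y (a₀ + a₁) = (∂₀ + ∂₁) b`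
  -- (`ring`); for `G₁`, `G₂` by the quotient rule off the kinks
  have hl : ∀ c d s : ℝ, HasDerivAt (fun u : ℝ => u * c + (1 - u) * d) (1 * c + (0 - 1) * d) s :=
    fun c d s => ((hasDerivAt_id' s).mul_const c).fun_add (((hasDerivAt_const s (1:ℝ)).fun_sub (hasDerivAt_id' s)).mul_const d)
  have hl' : ∀ c d s : ℝ, HasDerivAt (fun u : ℝ => (1 - u) * c + u * d) ((0 - 1) * c + 1 * d) s :=
    fun c d s => (((hasDerivAt_const s (1:ℝ)).fun_sub (hasDerivAt_id' s)).mul_const c).fun_add ((hasDerivAt_id' s).mul_const d)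
  have hG0der : ∀ x ∈ S, HasDerivAt (fun s : ℝ => G0 (Function.update x 2 s)) (D0 x) (x 2) := by
    intro x hx
    simp only [hG0, hD0, hD1, hD2, Function.update_self, Function.update_of_ne h02.1, Function.update_of_ne h02.2]
    have hRe := hl' (E (x 1)) (A (x 0)) (x 2)
    have hIm := hl' (F (x 1)) (B (x 0)) (x 2)
    have hq := (((hl (B' (x 0)) (F' (x 1)) (x 2)).fun_mul hRe).fun_sub
      ((hl (A' (x 0)) (E' (x 1)) (x 2)).fun_mul hIm)).fun_div
      ((hRe.fun_pow 2).fun_add (hIm.fun_pow 2)) (hNne x hx)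
    refine (((hl _ _ (x 2)).fun_sub hq).const_mul γ).congr_deriv ?_
    simp only [Nat.cast_ofNat, Nat.reduceSub, pow_one]
    ring
  have hGder : ∀ j, ∀ x ∈ S, x ∉ K j → x ((![2, 0, 1] : Fin 3 → Fin 4) j) ∈ Set.Ioo (0:ℝ) 1 →
      HasDerivAt (fun s : ℝ => G j (Function.update x ((![2, 0, 1] : Fin 3 → Fin 4) j) s)) (D j x)
        (x ((![2, 0, 1] : Fin 3 → Fin 4) j)) := by
    intro j
    fin_cases j
    · intro x hx _ _
      exact hG0der x hx
    · intro x hx hxK hx0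
      show HasDerivAt (fun s : ℝ => G1 (Function.update x 0 s)) (D1 x) (x 0)
      obtain ⟨hdA, hdB⟩ := hPd (x 0) hx0 fun h => hxK (show x ∈ {z : Fin 4 → ℝ | z 0 ∈ (kP : Set ℝ)} from h)
      simp only [hG1_x0, hD1]
      refine (((((hdB.mul_const _).fun_sub (hdA.mul_const _)).const_mul γ).fun_div
        ((((hdA.const_mul _).const_add _).fun_pow 2).fun_add (((hdB.const_mul _).const_add _).fun_pow 2))
        (hNne x hx)).congr_deriv ?_)
      simp only [Nat.cast_ofNat, Nat.reduceSub, pow_one]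
      ring
    · intro x hx hxK hx1
      show HasDerivAt (fun s : ℝ => G1 (Function.update x 1 s)) (D2 x) (x 1)
      obtain ⟨hdE, hdF⟩ := hQd (x 1) hx1 fun h => hxK (show x ∈ {z : Fin 4 → ℝ | z 1 ∈ (kQ : Set ℝ)} from h)
      simp only [hG1_x1, hD2]
      refine (((((hdE.const_mul _).fun_sub (hdF.const_mul _)).const_mul γ).fun_div
        ((((hdE.const_mul _).add_const _).fun_pow 2).fun_add (((hdF.const_mul _).add_const _).fun_pow 2))
        (hNne x hx)).congr_deriv ?_)
      simp only [Nat.cast_ofNat, Nat.reduceSub, pow_one]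
      ring
  -- continuity along closed fibres (`G₀`: differentiable along every `y`-fibre; `G₁ = G₂`: continuous on the cube)
  have hGfib : ∀ j, ∀ x ∈ S, ContinuousOn
      (fun s : ℝ => G j (Function.update x ((![2, 0, 1] : Fin 3 → Fin 4) j) s)) (Set.Icc (0:ℝ) 1) := by
    intro j x hx
    have hc : ∀ i : Fin 4, ContinuousOn (fun s : ℝ => G1 (Function.update x i s)) (Set.Icc (0:ℝ) 1) := fun i =>
      hG1sc.2.comp (continuous_const.update i continuous_id : Continuous fun s : ℝ => Function.update x i s).continuousOn
        fun s hs => hupd x hx i s hs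
    fin_cases j
    · show ContinuousOn (fun s : ℝ => G0 (Function.update x 2 s)) (Set.Icc (0:ℝ) 1)
      intro s hs
      have h := hG0der _ (hupd x hx 2 s hs)
      simp only [Function.update_idem, Function.update_self] at h
      exact h.continuousAt.continuousWithinAt
    · exact hc 0
    · exact hc 1
  -- the three closed-cube representations (bounded semialgebraic integrands are integrable)
  let r : Fin 3 → IntegralRep 4 := fun j =>
    { domain := S
      integrand := I j
      isSemialgebraic_domain := hSsa
      isSemialgebraicFunOn_integrand := (hIsb j).1
      integrableOn := (hIsb j).2.elim fun C hC => integrableOn_of_abs_le hSsa hSc.measure_lt_top.ne (hIsb j).1 hC }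
  refine ⟨G, D, K, r, fun j => ⟨(hGsb j).1, hDsa j, hK j, (hGsb j).2, hKfin j, hGfib j, hGder j⟩,
    ?_, fun x _ => ?_⟩
  · -- the integrand clauses
    intro j
    fin_cases j <;> refine ⟨rfl, fun x _ => ?_⟩
    · show D0 x = D0 x - (G0 (Function.update x 2 1) - G0 (Function.update x 2 0))
      rw [(hG0b x).1, (hG0b x).2, sub_zero, sub_zero]
    · exact congrFun hI1 x
    · exact congrFun hI2 x
  · -- `Σ integrands = γ (ω_P − ω_Q) − leftovers`: `D₀ + D₁ + D₂ = γ (ω_P − ω_Q)` by construction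
    rw [Fin.sum_univ_three]
    show D0 x + I1 x + I2 x = _
    simp only [hD0, hI1, hI2, hG1_x0, hG1_x1]
    ring

end Summit.KontsevichZagierPeriods.KontsevichZagierPeriods.Cruxes.StokesGeneration.FibrewiseStokes
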